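import Mathlib
import HarnessLib
import Summits.AtomisticToContinuum.Crystallization.Theorems.PricedLinkCensusSoftLayerPropagationStubBallPropagationLayers

/-!
# Local layer-propagation lemmas for the finite-ball form of Hales, *Dense Sphere Packings* §1.3 (IV):
# the in-layer steps in all six hexagon directions

Route `PricedLinkCensus`, crux `SoftLayerPropagation` (stmt-AtomisticToContinuum-14233), line
`Sketch`, fourth helper file for the stub `stub_ballPropagation` (frame `u₁ = triangularVec₁ 2`,
`u₂ = triangularVec₂ 2`, `w = barlowOffset 2`, `𝗁 e₃ = layerNormal layerSpacing` of
`LayerShells.lean`; uses `…StubBallPropagationLayers.lean`).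

The tree's in-layer propagation (`layer_subset_of_hcp`, `layer_subset_of_fcc`) walks the whole
lattice `ℤu₁ + ℤu₂` by the four unit steps `±u₁, ±u₂` (`lattice_induction`).  On a disc the walk
is a descent towards the centre of the disc (`…StubBallPropagationDisc.lean`), whose steps may be
any of the SIX hexagon vectors `±u₁, ±u₂, ±(u₁ − u₂)`; this file supplies the two missing hexagonal
pairs (directions `±(u₁ − u₂)`: hexagon, hole point, hole triple of both types) and packages the
localised FCC and HCP steps of `…Layers.lean` for an arbitrary hexagon direction:

* `kissingShell_add_eq_layerShell_of_hcp_dir` — Hales's HCP step: shell `layerShell s s` at `p`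
  and a pattern shell at `p + η` (`η ∈ hexagonSet`) give shell `layerShell s s` at `p + η`;
* `hexagonSet_subset_kissingShell_add_of_fcc_dir` — the FCC interlocking step: occupied hexagon
  at `p` and an FCC shell at `p + η` give the occupied hexagon at `p + η`;
* `holeTriple_type_eq_of_adjacent_dir` — type consistency of the hole triples carried by two
  adjacent centres `P, P + η` on the same side, for every hexagon direction `η` (the tree's
  `holeTriple_type_eq_of_adjacent` does `u₁, u₂`): the letter of the next layer is constant along
  a disc of full centres.

All statements are elementary ([folklore]) or cite DSP §1.3 as the tree lemmas they localise.
-/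

noncomputable section

namespace Summit.AtomisticToContinuum.Crystallization.Theorems

open Literature.Geometry.DiscreteGeometry Literature.MathematicalPhysics.StatisticalMechanics
open RealInnerProductSpace

/-! ### The two missing hexagonal pairs (directions `±(u₁ − u₂)`) -/

/-- Pair `(u₁ − u₂, −u₂)`: hexagon. [folklore] -/
theorem hexagonSet_eq_umv_nv : hexagonSet =
    ({triangularVec₁ 2 - triangularVec₂ 2, -(triangularVec₁ 2 - triangularVec₂ 2), -triangularVec₂ 2,
      -(-triangularVec₂ 2), triangularVec₁ 2 - triangularVec₂ 2 - -triangularVec₂ 2,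
      -triangularVec₂ 2 - (triangularVec₁ 2 - triangularVec₂ 2)} : Set (EuclideanSpace ℝ (Fin 3))) := by
  have e1 : (triangularVec₁ 2 : EuclideanSpace ℝ (Fin 3)) - triangularVec₂ 2 - -triangularVec₂ 2 =
      triangularVec₁ 2 := by abel
  have e2 : -(triangularVec₂ 2 : EuclideanSpace ℝ (Fin 3)) - (triangularVec₁ 2 - triangularVec₂ 2) =
      -triangularVec₁ 2 := by abel
  rw [e1, e2]
  ext x; simp only [hexagonSet, Set.mem_insert_iff, Set.mem_singleton_iff, neg_sub, neg_neg]; tauto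

/-- Pair `(u₁ − u₂, u₁)`: hexagon. [folklore] -/
theorem hexagonSet_eq_umv_u : hexagonSet =
    ({triangularVec₁ 2 - triangularVec₂ 2, -(triangularVec₁ 2 - triangularVec₂ 2), triangularVec₁ 2,
      -triangularVec₁ 2, triangularVec₁ 2 - triangularVec₂ 2 - triangularVec₁ 2,
      triangularVec₁ 2 - (triangularVec₁ 2 - triangularVec₂ 2)} : Set (EuclideanSpace ℝ (Fin 3))) := by
  have e1 : (triangularVec₁ 2 : EuclideanSpace ℝ (Fin 3)) - triangularVec₂ 2 - triangularVec₁ 2 =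
      -triangularVec₂ 2 := by abel
  have e2 : (triangularVec₁ 2 : EuclideanSpace ℝ (Fin 3)) - (triangularVec₁ 2 - triangularVec₂ 2) =
      triangularVec₂ 2 := by abel
  rw [e1, e2]
  ext x; simp only [hexagonSet, Set.mem_insert_iff, Set.mem_singleton_iff, neg_sub]; tauto

/-- Pair `(u₂ − u₁, −u₁)`: hexagon. [folklore] -/
theorem hexagonSet_eq_vmu_nu : hexagonSet =
    ({triangularVec₂ 2 - triangularVec₁ 2, -(triangularVec₂ 2 - triangularVec₁ 2), -triangularVec₁ 2,
      -(-triangularVec₁ 2), triangularVec₂ 2 - triangularVec₁ 2 - -triangularVec₁ 2,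
      -triangularVec₁ 2 - (triangularVec₂ 2 - triangularVec₁ 2)} : Set (EuclideanSpace ℝ (Fin 3))) := by
  have e1 : (triangularVec₂ 2 : EuclideanSpace ℝ (Fin 3)) - triangularVec₁ 2 - -triangularVec₁ 2 =
      triangularVec₂ 2 := by abel
  have e2 : -(triangularVec₁ 2 : EuclideanSpace ℝ (Fin 3)) - (triangularVec₂ 2 - triangularVec₁ 2) =
      -triangularVec₂ 2 := by abel
  rw [e1, e2]
  ext x; simp only [hexagonSet, Set.mem_insert_iff, Set.mem_singleton_iff, neg_sub, neg_neg]; tauto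

/-- Pair `(u₂ − u₁, u₂)`: hexagon. [folklore] -/
theorem hexagonSet_eq_vmu_v : hexagonSet =
    ({triangularVec₂ 2 - triangularVec₁ 2, -(triangularVec₂ 2 - triangularVec₁ 2), triangularVec₂ 2,
      -triangularVec₂ 2, triangularVec₂ 2 - triangularVec₁ 2 - triangularVec₂ 2,
      triangularVec₂ 2 - (triangularVec₂ 2 - triangularVec₁ 2)} : Set (EuclideanSpace ℝ (Fin 3))) := by
  have e1 : (triangularVec₂ 2 : EuclideanSpace ℝ (Fin 3)) - triangularVec₁ 2 - triangularVec₂ 2 =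
      -triangularVec₁ 2 := by abel
  have e2 : (triangularVec₂ 2 : EuclideanSpace ℝ (Fin 3)) - (triangularVec₂ 2 - triangularVec₁ 2) =
      triangularVec₁ 2 := by abel
  rw [e1, e2]
  ext x; simp only [hexagonSet, Set.mem_insert_iff, Set.mem_singleton_iff, neg_sub]; tauto

/-- `((u₁ − u₂) + (−u₂))/3 = w − u₂`. [folklore] -/
theorem third_smul_umv_add_nv : (1 / 3 : ℝ) • ((triangularVec₁ 2 : EuclideanSpace ℝ (Fin 3)) -
    triangularVec₂ 2 + -triangularVec₂ 2) = barlowOffset 2 - triangularVec₂ 2 := by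
  rw [frameW_eq]; module

/-- `((u₁ − u₂) + u₁)/3 = u₁ − w`. [folklore] -/
theorem third_smul_umv_add_u : (1 / 3 : ℝ) • ((triangularVec₁ 2 : EuclideanSpace ℝ (Fin 3)) -
    triangularVec₂ 2 + triangularVec₁ 2) = triangularVec₁ 2 - barlowOffset 2 := by
  rw [frameW_eq]; module

/-- `((u₂ − u₁) + (−u₁))/3 = w − u₁`. [folklore] -/
theorem third_smul_vmu_add_nu : (1 / 3 : ℝ) • ((triangularVec₂ 2 : EuclideanSpace ℝ (Fin 3)) -
    triangularVec₁ 2 + -triangularVec₁ 2) = barlowOffset 2 - triangularVec₁ 2 := by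
  rw [frameW_eq]; module

/-- `((u₂ − u₁) + u₂)/3 = u₂ − w`. [folklore] -/
theorem third_smul_vmu_add_v : (1 / 3 : ℝ) • ((triangularVec₂ 2 : EuclideanSpace ℝ (Fin 3)) -
    triangularVec₁ 2 + triangularVec₂ 2) = triangularVec₂ 2 - barlowOffset 2 := by
  rw [frameW_eq]; module

/-- Hole triple of the pair `(u₁ − u₂, −u₂)` (type `1`). [folklore] -/
theorem holeTriple_one_eq_umv_nv : holeTriple 1 =
    ({barlowOffset 2 - triangularVec₂ 2, barlowOffset 2 - triangularVec₂ 2 - (triangularVec₁ 2 -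
      triangularVec₂ 2), barlowOffset 2 - triangularVec₂ 2 - -triangularVec₂ 2} :
      Set (EuclideanSpace ℝ (Fin 3))) := by
  have e1 : (barlowOffset 2 : EuclideanSpace ℝ (Fin 3)) - triangularVec₂ 2 - (triangularVec₁ 2 -
      triangularVec₂ 2) = barlowOffset 2 - triangularVec₁ 2 := by abel
  have e2 : (barlowOffset 2 : EuclideanSpace ℝ (Fin 3)) - triangularVec₂ 2 - -triangularVec₂ 2 =
      barlowOffset 2 := by abel
  rw [e1, e2]
  ext x; simp only [holeTriple, one_smul, Set.mem_insert_iff, Set.mem_singleton_iff]; tauto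

/-- Hole triple of the pair `(u₁ − u₂, u₁)` (type `−1`). [folklore] -/
theorem holeTriple_neg_one_eq_umv_u : holeTriple (-1) =
    ({triangularVec₁ 2 - barlowOffset 2, triangularVec₁ 2 - barlowOffset 2 - (triangularVec₁ 2 -
      triangularVec₂ 2), triangularVec₁ 2 - barlowOffset 2 - triangularVec₁ 2} :
      Set (EuclideanSpace ℝ (Fin 3))) := by
  have e1 : (triangularVec₁ 2 : EuclideanSpace ℝ (Fin 3)) - barlowOffset 2 - (triangularVec₁ 2 -
      triangularVec₂ 2) = triangularVec₂ 2 - barlowOffset 2 := by abel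
  have e2 : (triangularVec₁ 2 : EuclideanSpace ℝ (Fin 3)) - barlowOffset 2 - triangularVec₁ 2 =
      -barlowOffset 2 := by abel
  rw [e1, e2]
  ext x
  simp only [holeTriple, neg_smul, one_smul, neg_sub, Set.mem_insert_iff, Set.mem_singleton_iff]
  tauto

/-- Hole triple of the pair `(u₂ − u₁, −u₁)` (type `1`). [folklore] -/
theorem holeTriple_one_eq_vmu_nu : holeTriple 1 =
    ({barlowOffset 2 - triangularVec₁ 2, barlowOffset 2 - triangularVec₁ 2 - (triangularVec₂ 2 -
      triangularVec₁ 2), barlowOffset 2 - triangularVec₁ 2 - -triangularVec₁ 2} :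
      Set (EuclideanSpace ℝ (Fin 3))) := by
  have e1 : (barlowOffset 2 : EuclideanSpace ℝ (Fin 3)) - triangularVec₁ 2 - (triangularVec₂ 2 -
      triangularVec₁ 2) = barlowOffset 2 - triangularVec₂ 2 := by abel
  have e2 : (barlowOffset 2 : EuclideanSpace ℝ (Fin 3)) - triangularVec₁ 2 - -triangularVec₁ 2 =
      barlowOffset 2 := by abel
  rw [e1, e2]
  ext x; simp only [holeTriple, one_smul, Set.mem_insert_iff, Set.mem_singleton_iff]; tauto

/-- Hole triple of the pair `(u₂ − u₁, u₂)` (type `−1`). [folklore] -/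
theorem holeTriple_neg_one_eq_vmu_v : holeTriple (-1) =
    ({triangularVec₂ 2 - barlowOffset 2, triangularVec₂ 2 - barlowOffset 2 - (triangularVec₂ 2 -
      triangularVec₁ 2), triangularVec₂ 2 - barlowOffset 2 - triangularVec₂ 2} :
      Set (EuclideanSpace ℝ (Fin 3))) := by
  have e1 : (triangularVec₂ 2 : EuclideanSpace ℝ (Fin 3)) - barlowOffset 2 - (triangularVec₂ 2 -
      triangularVec₁ 2) = triangularVec₁ 2 - barlowOffset 2 := by abel
  have e2 : (triangularVec₂ 2 : EuclideanSpace ℝ (Fin 3)) - barlowOffset 2 - triangularVec₂ 2 =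
      -barlowOffset 2 := by abel
  rw [e1, e2]
  ext x
  simp only [holeTriple, neg_smul, one_smul, neg_sub, Set.mem_insert_iff, Set.mem_singleton_iff]
  tauto

/-! ### Hales's HCP step in all six directions -/

/-- **HCP propagation step in any hexagon direction** (local form): if `p` has shell
`layerShell s s` and the shell of `p + η`, `η ∈ hexagonSet`, is a pattern, then `p + η` has shell
`layerShell s s`. [cite: HalesDSP2012, §1.3] -/
theorem kissingShell_add_eq_layerShell_of_hcp_dir {V : Set (EuclideanSpace ℝ (Fin 3))}
    (hV : IsUnitBallPacking V) {s : ℝ} (hs : s = 1 ∨ s = -1) {p : EuclideanSpace ℝ (Fin 3)}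
    (hp : p ∈ V) (hshell : kissingShell V p = layerShell s s) {η : EuclideanSpace ℝ (Fin 3)}
    (hη : η ∈ hexagonSet)
    (hpat : IsArrangedIn (kissingShell V (p + η)) fccKissingPattern ∨
      IsArrangedIn (kissingShell V (p + η)) hcpKissingPattern) :
    p + η ∈ V ∧ kissingShell V (p + η) = layerShell s s := by
  simp only [hexagonSet, Set.mem_insert_iff, Set.mem_singleton_iff] at hη
  rcases hη with rfl | rfl | rfl | rfl | rfl | rfl <;> rcases hs with rfl | rfl
  · exact kissingShell_add_eq_layerShell_of_hcp_local hV (η' := triangularVec₂ 2)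
      (w' := barlowOffset 2) (by norm_num) (by norm_num) (by norm_num) (by norm_num) (by norm_num)
      third_smul_u_add_v.symm hexagonSet_eq_uv (Or.inl rfl) holeTriple_one_eq_uv hp hshell hpat
  · exact kissingShell_add_eq_layerShell_of_hcp_local hV (η' := triangularVec₁ 2 - triangularVec₂ 2)
      (w' := triangularVec₁ 2 - barlowOffset 2) (by norm_num) inner_self_frameU_sub_frameV
      (by norm_num [inner_sub_right]) (by norm_num) (by norm_num [inner_sub_left])
      third_smul_u_add_umv.symm hexagonSet_eq_u_umv (Or.inr rfl) holeTriple_neg_one_eq_u_umv hp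
      hshell hpat
  · exact kissingShell_add_eq_layerShell_of_hcp_local hV (η' := triangularVec₂ 2 - triangularVec₁ 2)
      (w' := barlowOffset 2 - triangularVec₁ 2) (by norm_num) inner_self_frameV_sub_frameU
      (by norm_num [inner_sub_right]) (by norm_num) (by norm_num [inner_sub_left])
      third_smul_nu_add_vmu.symm hexagonSet_eq_nu_vmu (Or.inl rfl) holeTriple_one_eq_nu_vmu hp
      hshell hpat
  · exact kissingShell_add_eq_layerShell_of_hcp_local hV (η' := -triangularVec₂ 2)
      (w' := -barlowOffset 2) (by norm_num) (by norm_num) (by norm_num) (by norm_num) (by norm_num)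
      third_smul_nu_add_nv.symm hexagonSet_eq_nu_nv (Or.inr rfl) holeTriple_neg_one_eq_nu_nv hp
      hshell hpat
  · exact kissingShell_add_eq_layerShell_of_hcp_local hV (η' := triangularVec₁ 2)
      (w' := barlowOffset 2) (by norm_num) (by norm_num) (by norm_num) (by norm_num) (by norm_num)
      third_smul_v_add_u.symm hexagonSet_eq_vu (Or.inl rfl) holeTriple_one_eq_vu hp hshell hpat
  · exact kissingShell_add_eq_layerShell_of_hcp_local hV (η' := triangularVec₂ 2 - triangularVec₁ 2)
      (w' := triangularVec₂ 2 - barlowOffset 2) (by norm_num) inner_self_frameV_sub_frameU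
      (by norm_num [inner_sub_right]) (by norm_num) (by norm_num [inner_sub_left])
      third_smul_v_add_vmu.symm hexagonSet_eq_v_vmu (Or.inr rfl) holeTriple_neg_one_eq_v_vmu hp
      hshell hpat
  · exact kissingShell_add_eq_layerShell_of_hcp_local hV (η' := triangularVec₁ 2 - triangularVec₂ 2)
      (w' := barlowOffset 2 - triangularVec₂ 2) (by norm_num) inner_self_frameU_sub_frameV
      (by norm_num [inner_sub_right]) (by norm_num) (by norm_num [inner_sub_left])
      third_smul_nv_add_umv.symm hexagonSet_eq_nv_umv (Or.inl rfl) holeTriple_one_eq_nv_umv hp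
      hshell hpat
  · exact kissingShell_add_eq_layerShell_of_hcp_local hV (η' := -triangularVec₁ 2)
      (w' := -barlowOffset 2) (by norm_num) (by norm_num) (by norm_num) (by norm_num) (by norm_num)
      third_smul_nv_add_nu.symm hexagonSet_eq_nv_nu (Or.inr rfl) holeTriple_neg_one_eq_nv_nu hp
      hshell hpat
  · exact kissingShell_add_eq_layerShell_of_hcp_local hV (η' := -triangularVec₂ 2)
      (w' := barlowOffset 2 - triangularVec₂ 2) inner_self_frameU_sub_frameV (by norm_num)
      (by norm_num [inner_sub_left]) (by norm_num [inner_sub_left]) (by norm_num)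
      third_smul_umv_add_nv.symm hexagonSet_eq_umv_nv (Or.inl rfl) holeTriple_one_eq_umv_nv hp
      hshell hpat
  · exact kissingShell_add_eq_layerShell_of_hcp_local hV (η' := triangularVec₁ 2)
      (w' := triangularVec₁ 2 - barlowOffset 2) inner_self_frameU_sub_frameV (by norm_num)
      (by norm_num [inner_sub_left]) (by norm_num [inner_sub_left]) (by norm_num)
      third_smul_umv_add_u.symm hexagonSet_eq_umv_u (Or.inr rfl) holeTriple_neg_one_eq_umv_u hp
      hshell hpat
  · exact kissingShell_add_eq_layerShell_of_hcp_local hV (η' := -triangularVec₁ 2)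
      (w' := barlowOffset 2 - triangularVec₁ 2) inner_self_frameV_sub_frameU (by norm_num)
      (by norm_num [inner_sub_left]) (by norm_num [inner_sub_left]) (by norm_num)
      third_smul_vmu_add_nu.symm hexagonSet_eq_vmu_nu (Or.inl rfl) holeTriple_one_eq_vmu_nu hp
      hshell hpat
  · exact kissingShell_add_eq_layerShell_of_hcp_local hV (η' := triangularVec₂ 2)
      (w' := triangularVec₂ 2 - barlowOffset 2) inner_self_frameV_sub_frameU (by norm_num)
      (by norm_num [inner_sub_left]) (by norm_num [inner_sub_left]) (by norm_num)
      third_smul_vmu_add_v.symm hexagonSet_eq_vmu_v (Or.inr rfl) holeTriple_neg_one_eq_vmu_v hp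
      hshell hpat

/-! ### The FCC interlocking step in all six directions -/

/-- **FCC propagation step in any hexagon direction** (local form): if the hexagon of the centre
`p` is occupied and the shell of `p + η`, `η ∈ hexagonSet`, is an FCC pattern, then the hexagon of
`p + η` is occupied too (its shell contains the standard hexagon). [cite: HalesDSP2012, §1.3] -/
theorem hexagonSet_subset_kissingShell_add_of_fcc_dir {V : Set (EuclideanSpace ℝ (Fin 3))}
    {p : EuclideanSpace ℝ (Fin 3)} (hp : p ∈ V) (hH : ∀ x ∈ hexagonSet, p + x ∈ V)
    {η : EuclideanSpace ℝ (Fin 3)} (hη : η ∈ hexagonSet)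
    (hfcc : IsArrangedIn (kissingShell V (p + η)) fccKissingPattern) :
    hexagonSet ⊆ kissingShell V (p + η) := by
  have key : ∀ η' : EuclideanSpace ℝ (Fin 3),
      hexagonSet = ({η, -η, η', -η', η - η', η' - η} : Set (EuclideanSpace ℝ (Fin 3))) →
      ⟪η, η⟫ = 4 → ⟪η', η'⟫ = 4 → ⟪η, η'⟫ = 2 → hexagonSet ⊆ kissingShell V (p + η) := by
    intro η' hhex h1 h2 h3
    have h₂ : p + η' ∈ V := hH η' (by rw [hhex]; simp)
    have h₃ : p + (η - η') ∈ V := hH _ (by rw [hhex]; simp)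
    rw [hhex]
    exact hexagon_subset_kissingShell_add_of_fcc_local hfcc h1 h2 h3 hp h₂ h₃
  simp only [hexagonSet, Set.mem_insert_iff, Set.mem_singleton_iff] at hη
  rcases hη with rfl | rfl | rfl | rfl | rfl | rfl
  · exact key (triangularVec₂ 2) hexagonSet_eq_uv (by norm_num) (by norm_num) (by norm_num)
  · exact key (-triangularVec₂ 2) hexagonSet_eq_nu_nv (by norm_num) (by norm_num) (by norm_num)
  · exact key (triangularVec₁ 2) hexagonSet_eq_vu (by norm_num) (by norm_num) (by norm_num)
  · exact key (-triangularVec₁ 2) hexagonSet_eq_nv_nu (by norm_num) (by norm_num) (by norm_num)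
  · exact key (triangularVec₁ 2) hexagonSet_eq_umv_u inner_self_frameU_sub_frameV (by norm_num)
      (by norm_num [inner_sub_left])
  · exact key (triangularVec₂ 2) hexagonSet_eq_vmu_v inner_self_frameV_sub_frameU (by norm_num)
      (by norm_num [inner_sub_left])

/-! ### Type consistency of hole triples along any hexagon direction -/

/-- **Type consistency along the direction `u₁ − u₂`.**  If two adjacent centres `P, P + (u₁ − u₂)`
carry, on the same side `s`, hole triples of types `τ, τ′`, then `τ′ = τ` — otherwise `P + w + s𝗁e₃`
and `P + (u₁ − w) + s𝗁e₃` (resp. `P − w + s𝗁e₃` and `P + (w − u₂) + s𝗁e₃`) would be two centres at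
distance `2/√3 < 2` (cf. `holeTriple_type_eq_of_adjacent` for the directions `u₁, u₂`).
[cite: HalesDSP2012, §1.3 (Fig. 1.12)] -/
theorem holeTriple_type_eq_of_adjacent_umv {V : Set (EuclideanSpace ℝ (Fin 3))}
    (hV : IsUnitBallPacking V) {P : EuclideanSpace ℝ (Fin 3)} {s τ τ' : ℝ} (hτ : τ = 1 ∨ τ = -1)
    (hτ' : τ' = 1 ∨ τ' = -1)
    (hP : ∀ t ∈ holeTriple τ, t + s • layerNormal layerSpacing ∈ kissingShell V P)
    (hP' : ∀ t ∈ holeTriple τ',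
      t + s • layerNormal layerSpacing ∈ kissingShell V (P + (triangularVec₁ 2 - triangularVec₂ 2))) :
    τ' = τ := by
  by_contra hne
  -- two centres `P + a + s e`, `P + b + s e` with `⟪a − b, a − b⟫ = 4/3`
  have key : ∀ a b : EuclideanSpace ℝ (Fin 3), P + (a + s • layerNormal layerSpacing) ∈ V →
      P + (b + s • layerNormal layerSpacing) ∈ V → ⟪a - b, a - b⟫ = 4 / 3 → False := by
    intro a b ha hb hab
    have hd : dist (P + (a + s • layerNormal layerSpacing)) (P + (b + s • layerNormal layerSpacing)) < 2 := by
      rw [dist_add_left, dist_eq_norm, add_sub_add_right_eq_sub]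
      have h43 : ‖a - b‖ ^ 2 = 4 / 3 := by rw [← real_inner_self_eq_norm_sq]; exact hab
      nlinarith [norm_nonneg (a - b)]
    have heq := hV ha hb hd
    have h0 : a - b = 0 := by
      have := add_left_cancel heq
      have h' : a + s • layerNormal layerSpacing - (b + s • layerNormal layerSpacing) = 0 := by
        rw [this, sub_self]
      rwa [add_sub_add_right_eq_sub] at h'
    rw [h0, inner_zero_left] at hab
    norm_num at hab
  rcases hτ with rfl | rfl
  · have h1 : τ' = -1 := by rcases hτ' with rfl | rfl <;> [exact absurd rfl hne; rfl]
    subst h1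
    refine key (barlowOffset 2) (triangularVec₁ 2 - barlowOffset 2) (hP _ (by simp [holeTriple])).1 ?_ ?_
    · have h2 := (hP' (triangularVec₂ 2 - barlowOffset 2) (by simp [holeTriple])).1
      convert h2 using 1; abel
    · simp only [inner_sub_left, inner_sub_right, inner_frameW_frameW, inner_frameW_frameU,
        inner_frameU_frameW, inner_frameU_frameU]; norm_num
  · have h1 : τ' = 1 := by rcases hτ' with rfl | rfl <;> [rfl; exact absurd rfl hne]
    subst h1
    refine key (-barlowOffset 2) (barlowOffset 2 - triangularVec₂ 2) (hP _ (by simp [holeTriple])).1 ?_ ?_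
    · have h2 := (hP' (barlowOffset 2 - triangularVec₁ 2) (by simp [holeTriple])).1
      convert h2 using 1; abel
    · simp only [inner_sub_left, inner_sub_right, inner_neg_left, inner_neg_right, inner_frameW_frameW,
        inner_frameW_frameV, inner_frameV_frameW, inner_frameV_frameV]; norm_num

/-- **Type consistency along any hexagon direction**: adjacent centres `P, P + η` (`η ∈ hexagonSet`)
carrying hole triples of types `τ, τ′` on the same side `s` have `τ′ = τ` (`holeTriple_type_eq_of_adjacent`
for `u₁, u₂`, the same with the roles of the two centres exchanged for `−u₁, −u₂`, and
`holeTriple_type_eq_of_adjacent_umv` for `±(u₁ − u₂)`). [cite: HalesDSP2012, §1.3 (Fig. 1.12)] -/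
theorem holeTriple_type_eq_of_adjacent_dir {V : Set (EuclideanSpace ℝ (Fin 3))}
    (hV : IsUnitBallPacking V) {P η : EuclideanSpace ℝ (Fin 3)} (hη : η ∈ hexagonSet) {s τ τ' : ℝ}
    (hτ : τ = 1 ∨ τ = -1) (hτ' : τ' = 1 ∨ τ' = -1)
    (hP : ∀ t ∈ holeTriple τ, t + s • layerNormal layerSpacing ∈ kissingShell V P)
    (hP' : ∀ t ∈ holeTriple τ', t + s • layerNormal layerSpacing ∈ kissingShell V (P + η)) :
    τ' = τ := by
  simp only [hexagonSet, Set.mem_insert_iff, Set.mem_singleton_iff] at hη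
  rcases hη with rfl | rfl | rfl | rfl | rfl | rfl
  · exact holeTriple_type_eq_of_adjacent hV (Or.inl rfl) hτ hτ' hP hP'
  · have e : P + -triangularVec₁ 2 + triangularVec₁ 2 = P := by abel
    exact (holeTriple_type_eq_of_adjacent hV (P := P + -triangularVec₁ 2) (Or.inl rfl) hτ' hτ hP'
      (by rw [e]; exact hP)).symm
  · exact holeTriple_type_eq_of_adjacent hV (Or.inr rfl) hτ hτ' hP hP'
  · have e : P + -triangularVec₂ 2 + triangularVec₂ 2 = P := by abel
    exact (holeTriple_type_eq_of_adjacent hV (P := P + -triangularVec₂ 2) (Or.inr rfl) hτ' hτ hP'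
      (by rw [e]; exact hP)).symm
  · exact holeTriple_type_eq_of_adjacent_umv hV hτ hτ' hP hP'
  · have e : P + (triangularVec₂ 2 - triangularVec₁ 2) + (triangularVec₁ 2 - triangularVec₂ 2) = P := by
      abel
    exact (holeTriple_type_eq_of_adjacent_umv hV (P := P + (triangularVec₂ 2 - triangularVec₁ 2)) hτ'
      hτ hP' (by rw [e]; exact hP)).symm

/-- **Registered sub-goal `ballPropagation_hcpStepDir`** of the crux item (Hales's HCP step in any
hexagon direction, in closed form): `kissingShell_add_eq_layerShell_of_hcp_dir`. [folklore] -/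
theorem ballPropagation_hcpStepDir :
    ∀ (V : Set (EuclideanSpace ℝ (Fin 3))), Literature.Geometry.DiscreteGeometry.IsUnitBallPacking
    V → ∀ (s : ℝ), (s = 1 ∨ s = -1) → ∀ (p : EuclideanSpace ℝ (Fin 3)), p ∈ V →
    Literature.Geometry.DiscreteGeometry.kissingShell V p =
    Literature.Geometry.DiscreteGeometry.layerShell s s → ∀ η ∈
    Literature.Geometry.DiscreteGeometry.hexagonSet,
    (Literature.Geometry.DiscreteGeometry.IsArrangedIn
    (Literature.Geometry.DiscreteGeometry.kissingShell V (p + η))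
    Literature.Geometry.DiscreteGeometry.fccKissingPattern ∨
    Literature.Geometry.DiscreteGeometry.IsArrangedIn
    (Literature.Geometry.DiscreteGeometry.kissingShell V (p + η))
    Literature.Geometry.DiscreteGeometry.hcpKissingPattern) → p + η ∈ V ∧
    Literature.Geometry.DiscreteGeometry.kissingShell V (p + η) =
    Literature.Geometry.DiscreteGeometry.layerShell s s :=
  fun _ hV _ hs _ hp hshell _ hη hpat => kissingShell_add_eq_layerShell_of_hcp_dir hV hs hp hshell hη hpat

end Summit.AtomisticToContinuum.Crystallization.Theorems

end
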